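import Literature.Analysis.FluidPDE.JiaSverak2015.Statements
import Literature.Analysis.OperatorTheory.ReflectionSymmetricFredholm
import HarnessLib

/-!
# Jia–Šverák 2015 vs the numerically observed scenarios: the reflection-symmetric pitchfork kills
  condition ND1, and the unpublished assemblies of Guillod–Šverák 2023 / Hou–Wang–Yang 2025

Companion of `Statements.lean` (cell pub-nsjs, papers/NavierStokesRegularity/ns-jia-sverak). Two things:

1. **Divergence D2 (kernel-proved).** In a reflection-symmetric setting — the scenario computed by
   Guillod–Šverák, J. Math. Fluid Mech. 25 (2023), §1: datum `a₀ = e^{−4(z/r)²}(r²+z²)^{−1/2} e_θ` invariant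
   under `R : z ↦ −z`, base branch `U_σ` `R`-symmetric, crossing eigenvector `R`-ANTIsymmetric (their
   Result (2)) — the JS15 (B)-type non-degeneracy condition ND1, `ℙ(U_{σ₀}·∇U + U·∇U_{σ₀}) ∉ Range(𝓛_{σ₀})`,
   is FALSE (`nd1_false_of_reflection`), because the ND1 vector is `R`-symmetric and every `R`-symmetric
   vector lies in the range (`Literature.Analysis.OperatorTheory.symmetric_mem_range_of_antisymmetric_kernel`).
   Consequently the published theorem JS15 Thm. 5.2 cannot be invoked on the Guillod–Šverák data, whatever a
   spectral certificate shows (`assembly_B_unusable`); together with `not_spectralA_of_real_crossing`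
   (a real crossing is not scenario (A)) NEITHER published theorem of JS15 applies verbatim to that scenario.
   JS15 themselves say so informally (§4, after (4.6): "important non-generic case … We will not give the full
   details"). The hypothesis package `ReflectionReduction` records exactly what is assumed: the reduction of
   `𝓛_{σ₀}` to `1 − K` on `X` with `K` compact (JS15 Lemma 2.1 + 2.2, p.5–6), `K` commuting with `R`, the
   kernel spanned by an `R`-antisymmetric vector, and the `R`-symmetry of the ND1 vector.

2. **The assemblies that are NOT in print**, typed as hypothesis structures so that a future certificate can
   be plugged in honestly: `GSSetting.NGS` (Guillod–Šverák 2023, Thm. 1.4 — whose hypothesis is literally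
   "(ns-scale) exhibits the same solution behavior as observed in the above reported numerical results" and
   whose proof is sketched in their §6 through Thm. 6.1, a restatement of JS15 Thm. 1.2 in axisymmetric
   classes given without proof) with the typed reading `GSHypotheses` of that sketch (H-GS1–H-GS4), and
   `UMSetting.NUM` (the fixed-profile, single-real-unstable-eigenvalue variant of JS15 Thm. 4.1 used by
   Hou–Wang–Yang 2025, §2.2–2.3 — arXiv:2509.25116, an unrefereed computer-assisted claim; no such theorem is
   in the refereed literature) with hypotheses `UMHypotheses` (H-UM1–H-UM4: profile class, a simple real
   eigenvalue `λ₁ ∈ (0, 1/8)`, no eigenvalue with `Re ≥ 1/8` — required by JS15 Thm. 1.2 verbatim — and a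
   spectral gap). `noWorse_of_gap` fixes the dependency order of the certificates. `UMSetting.NUMHWY` is the
   package HWY25 §2.3 actually consumes (one eigenvalue with `Re > 0`, no window, no gap, no simplicity);
   `umHypothesesHWY_of_umHypotheses` shows it is the weaker one.

Everything proved here is functional analysis / propositional logic; no Navier–Stokes analysis enters.
Sign: JS15 (unstable ⇔ `Re λ > 0`).

## References

* H. Jia, V. Šverák, J. Funct. Anal. 268 (2015), §2 Lemmas 2.1–2.2, §4 (4.5)–(4.6) and the remark after
  them, §5. [JiaSverak2015]
* J. Guillod, V. Šverák, J. Math. Fluid Mech. 25 (2023), §1 (datum, Results (1)–(3)), Thm. 1.3, Thm. 1.4,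
  §6 (Thm. 6.1). [GuillodSverak2023]
* T. Y. Hou, Y. Wang, C. Yang, arXiv:2509.25116 (2025), Thm. 2, §2.2–2.3 (unrefereed; referenced as the
  scenario being typed, never cited as a fact). [HouWangYang2025]
-/

open MeasureTheory Set Filter Topology

namespace Literature.Analysis.FluidPDE.JiaSverak2015

/-- File-local notation, identical to `Statements.lean` and `HouWangYang2025Nonuniqueness.lean`. -/
local notation "ℝ³" => EuclideanSpace ℝ (Fin 3)

open Setting

/-- The reduction of `𝓛_{σ₀}` to `1 − K` on the Banach space `X` with a reflection `R` (JS15 Lem 2.1 + 2.2,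
p.5–6; Guillod–Šverák 2023 §1 for the symmetry): `Range(𝓛_{σ₀}) = Range(1 − K)`, `K` compact commuting with
`R`, the crossing kernel spanned by an `R`-antisymmetric `φ`, and the ND1 vector `R`-symmetric. A hypothesis
package (structure), never an instance. [cite: JiaSverak2015, Lemmas 2.1–2.2 p.5–6] -/
structure ReflectionReduction (S : Setting) (σ₀ : ℝ) [NormedAddCommGroup S.X] [NormedSpace ℝ S.X]
    [CompleteSpace S.X] where
  K : S.X →L[ℝ] S.X
  R : S.X →L[ℝ] S.X
  compact : IsCompactOperator K
  commute : ∀ x, K (R x) = R (K x)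
  range_eq : ∀ w, S.inRange σ₀ w ↔ ∃ v, v - K v = w
  φ : S.X
  antisym : R φ = -φ
  kernel_span : ∀ x, x - K x = 0 → ∃ c : ℝ, x = c • φ
  /-- the ND1 vector `ℙ(U_{σ₀}·∇U + U·∇U_{σ₀})` is `R`-symmetric (both `U_{σ₀}` and `U = e^Δ u₀` are). -/
  nd1_sym : R (S.nd1Vector σ₀) = S.nd1Vector σ₀

/-- **D2.** Under a reflection reduction, ND1 fails. Hence JS15 Thm. 5.2 is inapplicable to the
Guillod–Šverák scenario. [folklore] -/
theorem nd1_false_of_reflection (S : Setting) (σ₀ : ℝ) [NormedAddCommGroup S.X] [NormedSpace ℝ S.X]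
    [CompleteSpace S.X] (red : ReflectionReduction S σ₀) : ¬ S.ND1 σ₀ := by
  intro h
  apply h
  rw [red.range_eq]
  exact Literature.Analysis.OperatorTheory.symmetric_mem_range_of_antisymmetric_kernel red.K red.R
    red.compact red.commute red.φ red.antisym red.kernel_span (by norm_num) _ red.nd1_sym

/-- Consequently the published route through JS15 Thm. 5.2 cannot be closed by ANY certificate on
reflection-symmetric data: the hypothesis package of `assembly_B` is contradictory there. [folklore] -/
theorem assembly_B_unusable (S : Setting) (σ₀ δ : ℝ) [NormedAddCommGroup S.X] [NormedSpace ℝ S.X]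
    [CompleteSpace S.X] (red : ReflectionReduction S σ₀) :
    ¬ (S.SpectralB σ₀ δ ∧ S.ND1 σ₀ ∧ S.ND2 σ₀) := fun h => nd1_false_of_reflection S σ₀ red h.2.1

/-! ## Typed hypotheses of the Guillod–Šverák (bifurcation) path -/

/-- Data of the axisymmetric, `R`-symmetric Guillod–Šverák scenario (GŠ23 §1: `a₀ = e^{−4(z/r)²}(r²+z²)^{−1/2} e_θ`).
All spectra are on the AXISYMMETRIC domain `𝒟_axi` (their computations are restricted to it).
[cite: GuillodSverak2023, §1] -/
structure GSSetting extends Setting where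
  /-- `eigAxi σ`: eigenvalues of `𝓛_{U_σ}` on `𝒟_axi` (GŠ23 Result (2); JS sign). -/
  eigAxi : ℝ → Set ℂ
  /-- H-GS1: at parameter `σ` there are two distinct axisymmetric profiles with datum `σ a₀`, the second
  being `U_σ + V_σ` with `V_σ ∈ X_axi`, `V_σ ≠ 0`; `smallBranch σ ε` records `‖V_σ‖_X + ‖∇V_σ‖_X < ε` (H-GS2). -/
  twoProfiles : ℝ → Prop
  smallBranch : ℝ → ℝ → Prop
  /-- H-GS4: `U_σ ∈ Y_axi` with the JS14 decay `|∂^α(U_σ − σe^Δa₀)| ≤ C(1+|x|)^{−3−|α|}` (JS14 Thm. 4.1). -/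
  profileClass : ℝ → Prop

namespace GSSetting

variable (G : GSSetting)

/-- H-GS3 (GŠ23 §6, "`λ_σ > −1/8`" in their sign): all eigenvalues of `𝓛_{U_σ}` on `𝒟_axi` have
`Re < β < 1/8`. [cite: GuillodSverak2023, §6] -/
def SpecGapAxi (σ β : ℝ) : Prop := β < 1/8 ∧ ∀ z ∈ G.eigAxi σ, z.re < β

/-- The typed hypothesis of GŠ23 Thm. 1.4 as read off its proof sketch (§6): a sequence `σ_n → σ₀⁺` along
which H-GS1–H-GS4 hold with `‖V_{σ_n}‖ → 0`. [cite: GuillodSverak2023, Thm. 1.4 and §6] -/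
def GSHypotheses (σ₀ : ℝ) : Prop :=
  ∃ β < 1/8, ∀ ε > 0, ∃ σ, σ₀ ≤ σ ∧ σ < σ₀ + ε ∧ G.twoProfiles σ ∧ G.smallBranch σ ε ∧
    G.SpecGapAxi σ β ∧ G.profileClass σ

/-- **N-GS is NOT in print**: GŠ23 Thm. 1.4 assumes "the same solution behavior as observed in the numerical
results" and its proof (§6) is a sketch relying on GŠ23 Thm. 6.1, itself a restatement of JS15 Thm. 1.2 in
axisymmetric classes without proof. Recorded as a HYPOTHESIS structure; proving `implies` is a deliverable,
never a citation. [cite: GuillodSverak2023, Thm. 1.4] -/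
structure NGS where
  implies : ∀ σ₀, G.GSHypotheses σ₀ → (∃ (T : ℝ) (v₀ : ℝ³ → ℝ³) (u v : ℝ → ℝ³ → ℝ³), 0 < T ∧ JS15Datum v₀ ∧ IsNonUniqLHPair T v₀ u v)

/-- Assembly N-GS: modus ponens on the hypothesis structure. [folklore] -/
theorem assembly_GS (N : G.NGS) {σ₀ : ℝ} (h : G.GSHypotheses σ₀) : (∃ (T : ℝ) (v₀ : ℝ³ → ℝ³) (u v : ℝ → ℝ³ → ℝ³), 0 < T ∧ JS15Datum v₀ ∧ IsNonUniqLHPair T v₀ u v) := N.implies σ₀ h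

end GSSetting

/-! ## Typed hypotheses of the fixed-profile path -/

/-- Fixed-profile data (the Hou–Wang–Yang 2025 scenario, arXiv:2509.25116 Thm. 2; and the natural target of a
certified enclosure at fixed `σ`): one profile `Ũ` (no `σ`-curve) with eigenvalue set `eigU` of `𝓛_Ũ` on `𝒟`.
[cite: JiaSverak2015, §1 p.2–4] -/
structure UMSetting where
  /-- H-UM1: `Ũ ∈ Y`, axisymmetric, z-even, solves the profile equation with datum `A(x/|x|)/|x|`, JS14 decay. -/
  profileClass : Prop
  eigU : Set ℂ
  simple : ℂ → Prop

namespace UMSetting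

variable (M : UMSetting)

/-- H-UM2: a simple REAL eigenvalue `λ₁ ∈ (0, 1/8)` (JS sign; Hou–Wang–Yang 2025 report `λ̄ ≈ −0.11314` in
their sign, i.e. `λ₁ ≈ 0.1131 < 0.125`). The upper bound `1/8` is the window of JS15 Thm. 1.2.
[cite: JiaSverak2015, Thm. 1.2 p.4] -/
def UnstableEig (lam₁ : ℝ) : Prop := 0 < lam₁ ∧ lam₁ < 1/8 ∧ (lam₁ : ℂ) ∈ M.eigU ∧ M.simple lam₁

/-- H-UM3: `s(𝓛_Ũ) < 1/8` — NO eigenvalue with `Re ≥ 1/8` (required by JS15 Thm. 1.2 verbatim: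
`s(𝓛 − 𝒦(a)) < 1/8`). [cite: JiaSverak2015, Thm. 1.2 p.4] -/
def NoWorse : Prop := ∀ z ∈ M.eigU, z.re < 1/8

/-- H-UM4: spectral gap — every eigenvalue other than `λ₁` has `Re < −δ` (the shape required by the JS15
Thm. 4.1 unstable-manifold mechanism). [cite: JiaSverak2015, Thm. 4.1 p.12] -/
def Gap (lam₁ δ : ℝ) : Prop := 0 < δ ∧ ∀ z ∈ M.eigU, z = lam₁ ∨ z.re < -δ

/-- The fixed-profile hypothesis package H-UM1 ∧ H-UM2 ∧ H-UM3 ∧ H-UM4. [cite: JiaSverak2015, §1, Thm. 1.2, Thm. 4.1] -/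
def UMHypotheses : Prop := M.profileClass ∧ ∃ lam₁ δ, M.UnstableEig lam₁ ∧ M.NoWorse ∧ M.Gap lam₁ δ

/-- **N-UM is NOT in print**: JS15 Thm. 4.1 is stated under (A) (a `σ`-curve and a complex pair); the
fixed-profile, real-eigenvalue variant is JS15's proof *mutatis mutandis* (`X_u` one-dimensional) and must be
proved, not cited; Hou–Wang–Yang 2025 §2.3 give their own variant in `L²_σ` (unrefereed). Note also that
JS15 Thm. 4.1 and the proof of Thm. 5.1 ARRANGE `Re λ₁ ∈ (0, 1/32)` and `s ≤ 1/32` by taking `σ` close to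
`σ₀`; only Thm. 1.2's window is `1/8`, so with a fixed profile and `λ₁ ≈ 0.113 > 1/32` (HWY25) the variant
must also justify that `1/32` was a convenience of the `σ`-curve argument. The cite tag is a POINTER to the
theorem being varied, not a source for this statement. A HYPOTHESIS structure. A fixed-profile
theorem of the weaker shape `NUMHWY` (one eigenvalue with `Re λ > 0`, no window, no gap, no simplicity) is
claimed in the June 2026 preprint arXiv:2606.07501 (Ionescu–Jia–Palasek), Thm. 1.2; its typing as a claim-tagged
structure is proposed separately under `Literature/Analysis/FluidPDE/IonescuJiaPalasek2026/`. [cite: JiaSverak2015, Thm. 4.1 p.12] -/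
structure NUM where
  implies : M.UMHypotheses → (∃ (T : ℝ) (v₀ : ℝ³ → ℝ³) (u v : ℝ → ℝ³ → ℝ³), 0 < T ∧ JS15Datum v₀ ∧ IsNonUniqLHPair T v₀ u v)

/-- Assembly N-UM: modus ponens on the hypothesis structure. [folklore] -/
theorem assembly_UM (N : M.NUM) (h : M.UMHypotheses) : (∃ (T : ℝ) (v₀ : ℝ³ → ℝ³) (u v : ℝ → ℝ³ → ℝ³), 0 < T ∧ JS15Datum v₀ ∧ IsNonUniqLHPair T v₀ u v) := N.implies h

/-- Gap ⇒ NoWorse when `λ₁ < 1/8`: H-UM4 (with H-UM2) subsumes H-UM3. It fixes the dependency order of the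
certificates: the spectral exclusion discharges both. [folklore] -/
theorem noWorse_of_gap {lam₁ δ : ℝ} (h : M.UnstableEig lam₁) (hg : M.Gap lam₁ δ) : M.NoWorse := by
  intro z hz
  rcases hg.2 z hz with rfl | hlt
  · simpa using h.2.1
  · linarith [hg.1]

/-! ### The HWY25 §2.3 variant (audit HWY-SEC23-AUDIT.md)

HWY25 §2.3 runs the unstable directions of the Lyapunov–Perron fixed point backward from `τ = 0`, so it
needs NEITHER the `1/8` window (JS15 Thm. 1.2) NOR a spectral gap NOR simplicity: its spectral input is
one eigenvalue with positive real part (plus the essential-spectrum bound `Re ≤ -1/4`, which is part of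
the profile class in this model). We record the weaker package and the implication from the JS-shaped one. -/

/-- H-UM2′: some eigenvalue of `𝓛_Ũ` on `L²_σ` has positive real part (no bound, no simplicity).
[cite: HouWangYang2025, §2.3, decomposition after (duh1)] -/
def UnstableEigAny : Prop := ∃ z ∈ M.eigU, 0 < z.re

/-- The hypothesis package actually consumed by HWY25 §2.3: profile class and one unstable eigenvalue.
[cite: HouWangYang2025, §2.3] -/
def UMHypothesesHWY : Prop := M.profileClass ∧ M.UnstableEigAny

/-- The HWY25 §2.3 assembly as a named hypothesis node: the displayed argument (Thm. 1, proof in §2.3) is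
under audit, so its conclusion enters as a hypothesis, never as a fact. [cite: HouWangYang2025, Thm. 1] -/
structure NUMHWY where
  implies : M.UMHypothesesHWY → (∃ (T : ℝ) (v₀ : ℝ³ → ℝ³) (u v : ℝ → ℝ³ → ℝ³), 0 < T ∧ JS15Datum v₀ ∧ IsNonUniqLHPair T v₀ u v)

/-- Assembly for the HWY-shaped package: modus ponens on the hypothesis structure. [folklore] -/
theorem assembly_UMHWY (N : M.NUMHWY) (h : M.UMHypothesesHWY) : (∃ (T : ℝ) (v₀ : ℝ³ → ℝ³) (u v : ℝ → ℝ³ → ℝ³), 0 < T ∧ JS15Datum v₀ ∧ IsNonUniqLHPair T v₀ u v) := N.implies h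

/-- The JS-shaped package (H-UM1–H-UM4) is strictly stronger than what HWY25 §2.3 consumes. [folklore] -/
theorem umHypothesesHWY_of_umHypotheses (h : M.UMHypotheses) : M.UMHypothesesHWY := by
  obtain ⟨hp, lam₁, δ, hu, -, -⟩ := h
  exact ⟨hp, (lam₁ : ℂ), hu.2.2.1, by simpa using hu.1⟩

/-- Hence any JS-shaped assembly is obtained from the HWY-shaped one. [folklore] -/
theorem NUM.ofHWY (N : M.NUMHWY) : M.NUM := ⟨fun h => N.implies (M.umHypothesesHWY_of_umHypotheses h)⟩

end UMSetting

end Literature.Analysis.FluidPDE.JiaSverak2015
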